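import Mathlib.Analysis.SpecialFunctions.Complex.Arg
import Mathlib.Tactic.Module
import Literature.Geometry.DiscreteGeometry.KissingNodeDegree

/-!
# FrustratedLawDichotomy · crux `AperiodicFrustratedLawGap` (stmt-AtomisticToContinuum-27623) — THE LENS LEMMA: two points at distance
# `≥ d₀` have at most FOUR common near-unit neighbours that are pairwise separated (a perturbed form of Hales 2012, Lemma 7)
# (decomp-a2c, prover hand 2, gen 10)

Hales's Lemma 7 (`Literature/Geometry/DiscreteGeometry/KissingNodeDegree`, proved there): two touching unit balls have at most four common
touching neighbours — five tangent directions around the bond would have five cyclic gaps `≥ arccos (1/3) ≈ 70.5°`.  The P-side certificate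
`CapMatchCert θ Pat` of the FLD column (p822220) is, at bottom, the same count for a NON-bonded pair: if the two half-caps `m₁ ≠ m₂` of a
square `{a, w₁, b, w₂}` of the link of `0` were distinct, the diagonal pair `p a, p b` would have FIVE common neighbours `0, p w₁, p w₂, m₁,
m₂` inside the distance window `[1/(1+θ), (1+θ)²]`, pairwise `≥ 1/(1+θ)²` apart.  This def-free file proves the metric core, with the window as
parameters:

* ★ `lens_five_false` : `A, B` with `dist A B ≥ d₀ > 0`; five points `P k` with `lo ≤ dist (P k) A ² ≤ hi`, `lo ≤ dist (P k) B ² ≤ hi`,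
  pairwise `dist ≥ s ≥ 0`; and `(5 − √5)/2 · (hi − d₀²/4) < s² − ((hi − lo)/d₀)²`.  Then `False`.
  Proof: in an orthonormal frame with third axis `B − A` the five points have axial coordinate `|h| ≤ (hi − lo)/(2d₀)` about the mid-plane
  and planar radius `ρ² ≤ hi − d₀²/4 =: R²`; planar separations are `≥ s'`, `s'² = s² − ((hi − lo)/d₀)²`; five planar directions have two
  within `2π/5` (sorting, as in `KissingNodeDegree`), and two points of the disc of radius `R` within angle `2π/5` are `≤ √(2 − 2cos(2π/5))·R
  = √((5 − √5)/2)·R` apart (the regular pentagon is extremal).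
* pieces: `cos_two_pi_div_five_bounds`, `five_sorted_angles_exists_cos_ge` (five sorted directions on a circle have a gap `≤ 2π/5`),
  `planar_dist_sq` (planar law of cosines via `Complex.arg`), `planar_bound`, `dist_sq_decomp`, `dist_sq_eq_sum_sq`.
Used by `FrustratedLawDichotomyCapMatchOfDiagonal`: `CapMatchCert θ Pat ⟸` «square diagonals of an admissible link are `≥ d₀`» (a 12-point
scalar bound) whenever `(θ, d₀)` satisfy the numerical condition (e.g. `θ = 1/100`, `d₀ = 6/5`).  `[folklore]`; def-free; no `sorry`.
-/

noncomputable section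

namespace Summit.AtomisticToContinuum.Crystallization.Theorems.FrustratedLawDichotomyLensFive

open Real RealInnerProductSpace
open Literature.Geometry.DiscreteGeometry (exists_orthonormalBasis_third_eq inner_eq_sum_three)

/-! ### §A Angles -/

/-- `0 ≤ cos (2π/5) ≤ 1/2` and `2 − 2 cos (2π/5) = (5 − √5)/2` (the value `cos (2π/5) = (√5 − 1)/4` is
`Summit.AtomisticToContinuum.Crystallization.Theorems.cos_two_pi_div_five` of the PricedLinkCensus toolkit; recomputed inline from
`Real.cos_pi_div_five` to keep this file's imports light). [folklore] -/
theorem cos_two_pi_div_five_bounds :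
    0 ≤ cos (2 * π / 5) ∧ cos (2 * π / 5) ≤ 1 / 2 ∧ 2 - 2 * cos (2 * π / 5) = (5 - Real.sqrt 5) / 2 := by
  have h5 : Real.sqrt 5 ^ 2 = 5 := Real.sq_sqrt (by norm_num)
  have hc : cos (2 * π / 5) = (Real.sqrt 5 - 1) / 4 := by
    rw [show 2 * π / 5 = 2 * (π / 5) by ring, cos_two_mul, cos_pi_div_five]
    linear_combination (1 / 8) * h5
  rw [hc]
  have h1 : (1 : ℝ) ≤ Real.sqrt 5 := by
    rw [show (1 : ℝ) = Real.sqrt 1 by simp]; exact Real.sqrt_le_sqrt (by norm_num)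
  have h3 : Real.sqrt 5 ≤ 3 := by
    rw [show (3 : ℝ) = Real.sqrt 9 by rw [show (9 : ℝ) = 3 ^ 2 by norm_num, Real.sqrt_sq (by norm_num)]]
    exact Real.sqrt_le_sqrt (by norm_num)
  refine ⟨by linarith, by linarith, by ring⟩

/-- **Five sorted directions on a circle have two within `2π/5`.**  For `−π < t₀ < t₁ < ⋯ < t₄ ≤ π` some pair `i ≠ j` has
`cos (2π/5) ≤ cos (tᵢ − tⱼ)` (one of the five cyclic gaps is `≤ 2π/5`). [folklore] -/
theorem five_sorted_angles_exists_cos_ge (t : Fin 5 → ℝ) (hmono : StrictMono t) (hlo : -π < t 0) (hhi : t 4 ≤ π) :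
    ∃ i j : Fin 5, i ≠ j ∧ cos (2 * π / 5) ≤ cos (t i - t j) := by
  have h01 : t 0 < t 1 := hmono (by decide)
  have h12 : t 1 < t 2 := hmono (by decide)
  have h23 : t 2 < t 3 := hmono (by decide)
  have h34 : t 3 < t 4 := hmono (by decide)
  have hπ5 : 2 * π / 5 ≤ π := by linarith [pi_pos]
  by_cases g1 : t 1 - t 0 ≤ 2 * π / 5
  · exact ⟨1, 0, by decide, cos_le_cos_of_nonneg_of_le_pi (by linarith) hπ5 g1⟩
  by_cases g2 : t 2 - t 1 ≤ 2 * π / 5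
  · exact ⟨2, 1, by decide, cos_le_cos_of_nonneg_of_le_pi (by linarith) hπ5 g2⟩
  by_cases g3 : t 3 - t 2 ≤ 2 * π / 5
  · exact ⟨3, 2, by decide, cos_le_cos_of_nonneg_of_le_pi (by linarith) hπ5 g3⟩
  by_cases g4 : t 4 - t 3 ≤ 2 * π / 5
  · exact ⟨4, 3, by decide, cos_le_cos_of_nonneg_of_le_pi (by linarith) hπ5 g4⟩
  push Not at g1 g2 g3 g4
  have g5 : 2 * π - (t 4 - t 0) ≤ 2 * π / 5 := by linarith
  refine ⟨4, 0, by decide, ?_⟩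
  rw [← cos_two_pi_sub (t 4 - t 0)]
  exact cos_le_cos_of_nonneg_of_le_pi (by linarith) hπ5 g5

/-! ### §B The plane: polar coordinates, and two points of a disc within angle `2π/5` -/

/-- **Planar law of cosines** in polar form (`ρ = ‖(X, Y)‖`, `θ = arg (X + iY)`):
`(X − X')² + (Y − Y')² = ρ² + ρ'² − 2ρρ' cos (θ − θ')`. [folklore] -/
theorem planar_dist_sq (X Y X' Y' : ℝ) :
    (X - X') ^ 2 + (Y - Y') ^ 2 =
      ‖(⟨X, Y⟩ : ℂ)‖ ^ 2 + ‖(⟨X', Y'⟩ : ℂ)‖ ^ 2 -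
        2 * (‖(⟨X, Y⟩ : ℂ)‖ * ‖(⟨X', Y'⟩ : ℂ)‖) * cos (Complex.arg ⟨X, Y⟩ - Complex.arg ⟨X', Y'⟩) := by
  have hX := Complex.norm_mul_cos_arg (⟨X, Y⟩ : ℂ)
  have hY := Complex.norm_mul_sin_arg (⟨X, Y⟩ : ℂ)
  have hX' := Complex.norm_mul_cos_arg (⟨X', Y'⟩ : ℂ)
  have hY' := Complex.norm_mul_sin_arg (⟨X', Y'⟩ : ℂ)
  change _ = X at hX
  change _ = Y at hY
  change _ = X' at hX'
  change _ = Y' at hY'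
  generalize ‖(⟨X, Y⟩ : ℂ)‖ = ρ at *
  generalize ‖(⟨X', Y'⟩ : ℂ)‖ = ρ' at *
  generalize Complex.arg ⟨X, Y⟩ = θ at *
  generalize Complex.arg ⟨X', Y'⟩ = θ' at *
  have h1 := sin_sq_add_cos_sq θ
  have h2 := sin_sq_add_cos_sq θ'
  rw [cos_sub]
  linear_combination (-(X + ρ * cos θ - 2 * X')) * hX + (-(X' + ρ' * cos θ' - 2 * (ρ * cos θ))) * hX' +
    (-(Y + ρ * sin θ - 2 * Y')) * hY + (-(Y' + ρ' * sin θ' - 2 * (ρ * sin θ))) * hY' + ρ ^ 2 * h1 + ρ' ^ 2 * h2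

/-- **Two points of the disc of radius `R` within angle `arccos c`, `c ≥ c₀`, `c₀ ≤ 1/2`, are at squared distance `≤ (2 − 2c₀) R²`**
(the maximum of `ρ² + ρ'² − 2ρρ'c` over `0 ≤ ρ, ρ' ≤ R` is at `ρ = ρ' = R`). [folklore] -/
theorem planar_bound {ρ ρ' R c c₀ : ℝ} (hρ0 : 0 ≤ ρ) (hρR : ρ ≤ R) (hρ'0 : 0 ≤ ρ') (hρ'R : ρ' ≤ R)
    (hc₀ : c₀ ≤ 1 / 2) (hc : c₀ ≤ c) : ρ ^ 2 + ρ' ^ 2 - 2 * (ρ * ρ') * c ≤ (2 - 2 * c₀) * R ^ 2 := by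
  have h1 : ρ * ρ' * c₀ ≤ ρ * ρ' * c := mul_le_mul_of_nonneg_left hc (mul_nonneg hρ0 hρ'0)
  have h2 : ρ ^ 2 + ρ' ^ 2 - ρ * ρ' ≤ R ^ 2 := by
    nlinarith [mul_nonneg (sub_nonneg.2 hρR) hρ0, mul_nonneg (sub_nonneg.2 hρ'R) hρ'0,
      mul_nonneg (sub_nonneg.2 hρR) (sub_nonneg.2 hρ'R)]
  have h3 : ρ * ρ' ≤ R ^ 2 := by nlinarith [mul_le_mul hρR hρ'R hρ'0 (hρ0.trans hρR)]
  nlinarith [mul_le_mul_of_nonneg_left h3 (by linarith : (0 : ℝ) ≤ 1 - 2 * c₀)]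

/-! ### §C Frames in `ℝ³`: axial and planar coordinates about the segment `[A, B]` -/

/-- An orthonormal frame whose third vector points from `A` to `B`. [folklore] -/
theorem exists_frame {A B : EuclideanSpace ℝ (Fin 3)} (h : A ≠ B) :
    ∃ b : OrthonormalBasis (Fin 3) ℝ (EuclideanSpace ℝ (Fin 3)), B - A = dist A B • b 2 := by
  have hd : 0 < dist A B := dist_pos.2 h
  have hv : ‖(2 / dist A B) • (B - A)‖ = 2 := by
    rw [norm_smul, Real.norm_of_nonneg (by positivity), norm_sub_rev, ← dist_eq_norm, div_mul_cancel₀ _ hd.ne']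
  obtain ⟨b, hb⟩ := exists_orthonormalBasis_third_eq hv
  refine ⟨b, ?_⟩
  rw [hb, smul_smul, smul_smul]
  rw [show dist A B * (1 / 2) * (2 / dist A B) = 1 by field_simp, one_smul]

/-- **Distances to `A` and `B` in the frame**: with `Q = P − (A + B)/2`, coordinates `x, y, h` of `Q` in an orthonormal frame `b` with
`B − A = d • b 2`: `dist P A ² = x² + y² + h² + d h + d²/4` and `dist P B ² = x² + y² + h² − d h + d²/4`. [folklore] -/
theorem dist_sq_decomp (b : OrthonormalBasis (Fin 3) ℝ (EuclideanSpace ℝ (Fin 3))) {A B : EuclideanSpace ℝ (Fin 3)} {d : ℝ}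
    (hBA : B - A = d • b 2) (P : EuclideanSpace ℝ (Fin 3)) :
    dist P A ^ 2 = ⟪b 0, P - (1 / 2 : ℝ) • (A + B)⟫ ^ 2 + ⟪b 1, P - (1 / 2 : ℝ) • (A + B)⟫ ^ 2 +
        ⟪b 2, P - (1 / 2 : ℝ) • (A + B)⟫ ^ 2 + d * ⟪b 2, P - (1 / 2 : ℝ) • (A + B)⟫ + d ^ 2 / 4 ∧
      dist P B ^ 2 = ⟪b 0, P - (1 / 2 : ℝ) • (A + B)⟫ ^ 2 + ⟪b 1, P - (1 / 2 : ℝ) • (A + B)⟫ ^ 2 +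
        ⟪b 2, P - (1 / 2 : ℝ) • (A + B)⟫ ^ 2 - d * ⟪b 2, P - (1 / 2 : ℝ) • (A + B)⟫ + d ^ 2 / 4 := by
  set Q := P - (1 / 2 : ℝ) • (A + B) with hQ
  have he : ‖b 2‖ = 1 := b.orthonormal.1 2
  have hPA : P - A = Q + (d / 2) • b 2 := by
    have h1 : P - A = Q + (1 / 2 : ℝ) • (B - A) := by simp only [hQ]; module
    rw [h1, hBA, smul_smul, show (1 / 2 : ℝ) * d = d / 2 by ring]
  have hPB : P - B = Q - (d / 2) • b 2 := by
    have h1 : P - B = Q - (1 / 2 : ℝ) • (B - A) := by simp only [hQ]; module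
    rw [h1, hBA, smul_smul, show (1 / 2 : ℝ) * d = d / 2 by ring]
  have hQQ : ‖Q‖ ^ 2 = ⟪b 0, Q⟫ ^ 2 + ⟪b 1, Q⟫ ^ 2 + ⟪b 2, Q⟫ ^ 2 := by
    rw [← real_inner_self_eq_norm_sq, inner_eq_sum_three b Q Q]; ring
  have hn2 : ‖(d / 2) • b 2‖ ^ 2 = d ^ 2 / 4 := by
    rw [norm_smul, he, mul_one, Real.norm_eq_abs, sq_abs]; ring
  have hin : ⟪Q, (d / 2) • b 2⟫ = (d / 2) * ⟪b 2, Q⟫ := by rw [real_inner_smul_right, real_inner_comm]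
  constructor
  · rw [dist_eq_norm, hPA, norm_add_sq_real, hQQ, hin, hn2]; ring
  · rw [dist_eq_norm, hPB, norm_sub_sq_real, hQQ, hin, hn2]; ring

/-- **Pairwise distances in the frame** (Parseval): `dist P P' ² = Σₖ (⟪bₖ, P − M⟫ − ⟪bₖ, P' − M⟫)²`. [folklore] -/
theorem dist_sq_eq_sum_sq (b : OrthonormalBasis (Fin 3) ℝ (EuclideanSpace ℝ (Fin 3))) (M P P' : EuclideanSpace ℝ (Fin 3)) :
    dist P P' ^ 2 = (⟪b 0, P - M⟫ - ⟪b 0, P' - M⟫) ^ 2 + (⟪b 1, P - M⟫ - ⟪b 1, P' - M⟫) ^ 2 +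
      (⟪b 2, P - M⟫ - ⟪b 2, P' - M⟫) ^ 2 := by
  have h : P - P' = (P - M) - (P' - M) := by abel
  rw [dist_eq_norm, h, ← real_inner_self_eq_norm_sq, inner_eq_sum_three b]
  simp only [inner_sub_right]
  ring

/-! ### §D The lens lemma -/

/-- ★ **THE LENS LEMMA (perturbed Hales Lemma 7).**  Two points `A, B` at distance `≥ d₀ > 0` do not have five common neighbours `P₀ … P₄`
in the squared-distance window `[lo, hi]` that are pairwise `≥ s` apart, provided `(5 − √5)/2 · (hi − d₀²/4) < s² − ((hi − lo)/d₀)²`.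
[folklore] -/
theorem lens_five_false {A B : EuclideanSpace ℝ (Fin 3)} {P : Fin 5 → EuclideanSpace ℝ (Fin 3)} {d₀ lo hi s : ℝ}
    (hd₀ : 0 < d₀) (hd : d₀ ≤ dist A B)
    (hA : ∀ k, lo ≤ dist (P k) A ^ 2 ∧ dist (P k) A ^ 2 ≤ hi) (hB : ∀ k, lo ≤ dist (P k) B ^ 2 ∧ dist (P k) B ^ 2 ≤ hi)
    (hs : 0 ≤ s) (hsep : ∀ i j, i ≠ j → s ≤ dist (P i) (P j))
    (hnum : (5 - Real.sqrt 5) / 2 * (hi - d₀ ^ 2 / 4) < s ^ 2 - ((hi - lo) / d₀) ^ 2) : False := by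
  set d := dist A B with hd_def
  have hdpos : 0 < d := hd₀.trans_le hd
  have hAB : A ≠ B := fun h => by rw [hd_def, h, dist_self] at hdpos; exact lt_irrefl _ hdpos
  obtain ⟨b, hBA⟩ := exists_frame hAB
  rw [← hd_def] at hBA
  set M : EuclideanSpace ℝ (Fin 3) := (1 / 2 : ℝ) • (A + B) with hM
  -- coordinates
  set X : Fin 5 → ℝ := fun k => ⟪b 0, P k - M⟫ with hXdef
  set Y : Fin 5 → ℝ := fun k => ⟪b 1, P k - M⟫ with hYdef
  set H : Fin 5 → ℝ := fun k => ⟪b 2, P k - M⟫ with hHdef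
  have key : ∀ k, dist (P k) A ^ 2 = X k ^ 2 + Y k ^ 2 + H k ^ 2 + d * H k + d ^ 2 / 4 ∧
      dist (P k) B ^ 2 = X k ^ 2 + Y k ^ 2 + H k ^ 2 - d * H k + d ^ 2 / 4 := fun k => dist_sq_decomp b hBA (P k)
  -- the window bounds
  have hlohi : lo ≤ hi := (hA 0).1.trans (hA 0).2
  set δ : ℝ := (hi - lo) / (2 * d₀) with hδ
  have hH : ∀ k, |H k| ≤ δ := by
    intro k
    obtain ⟨hk1, hk2⟩ := key k
    have hdH : |d * H k| ≤ (hi - lo) / 2 := by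
      rw [abs_le]; constructor <;> nlinarith [(hA k).1, (hA k).2, (hB k).1, (hB k).2]
    rw [abs_mul, abs_of_pos hdpos] at hdH
    rw [hδ, le_div_iff₀ (by positivity)]
    calc |H k| * (2 * d₀) ≤ |H k| * (2 * d) := by gcongr
      _ = 2 * (d * |H k|) := by ring
      _ ≤ 2 * ((hi - lo) / 2) := by gcongr
      _ = hi - lo := by ring
  set R2 : ℝ := hi - d₀ ^ 2 / 4 with hR2
  have hρ2 : ∀ k, X k ^ 2 + Y k ^ 2 ≤ R2 := by
    intro k
    obtain ⟨hk1, hk2⟩ := key k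
    have hdd : d₀ ^ 2 ≤ d ^ 2 := pow_le_pow_left₀ hd₀.le hd 2
    nlinarith [(hA k).2, (hB k).2, sq_nonneg (H k)]
  have hR2nn : 0 ≤ R2 := by nlinarith [hρ2 0, sq_nonneg (X 0), sq_nonneg (Y 0)]
  set R : ℝ := Real.sqrt R2 with hR
  have hRsq : R ^ 2 = R2 := Real.sq_sqrt hR2nn
  -- planar separation
  set S2 : ℝ := s ^ 2 - ((hi - lo) / d₀) ^ 2 with hS2
  have hplanar : ∀ i j, i ≠ j → S2 ≤ (X i - X j) ^ 2 + (Y i - Y j) ^ 2 := by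
    intro i j hij
    have h1 : dist (P i) (P j) ^ 2 = (X i - X j) ^ 2 + (Y i - Y j) ^ 2 + (H i - H j) ^ 2 := dist_sq_eq_sum_sq b M (P i) (P j)
    have h2 : s ^ 2 ≤ dist (P i) (P j) ^ 2 := pow_le_pow_left₀ hs (hsep i j hij) 2
    have h3 : (H i - H j) ^ 2 ≤ ((hi - lo) / d₀) ^ 2 := by
      have hi' := hH i
      have hj' := hH j
      rw [abs_le] at hi' hj'
      have h2δ : 2 * δ = (hi - lo) / d₀ := by rw [hδ]; field_simp
      rw [← h2δ]
      nlinarith [hi'.1, hi'.2, hj'.1, hj'.2]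
    rw [hS2]; linarith
  -- polar data
  set θ : Fin 5 → ℝ := fun k => Complex.arg ⟨X k, Y k⟩ with hθdef
  set ρ : Fin 5 → ℝ := fun k => ‖(⟨X k, Y k⟩ : ℂ)‖ with hρdef
  have hρnn : ∀ k, 0 ≤ ρ k := fun k => norm_nonneg _
  have hρsq : ∀ k, ρ k ^ 2 = X k ^ 2 + Y k ^ 2 := by
    intro k
    simp only [hρdef]
    rw [Complex.norm_def, Real.sq_sqrt (Complex.normSq_nonneg _), Complex.normSq_mk]; ring
  have hρR : ∀ k, ρ k ≤ R := by
    intro k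
    rw [hR, ← Real.sqrt_sq (hρnn k)]
    exact Real.sqrt_le_sqrt (by rw [hρsq]; exact hρ2 k)
  have hpl : ∀ i j, (X i - X j) ^ 2 + (Y i - Y j) ^ 2 = ρ i ^ 2 + ρ j ^ 2 - 2 * (ρ i * ρ j) * cos (θ i - θ j) :=
    fun i j => planar_dist_sq (X i) (Y i) (X j) (Y j)
  obtain ⟨-, hc12, hcc⟩ := cos_two_pi_div_five_bounds
  -- a pair within angle 2π/5 gives the contradiction
  have pair_false : ∀ i j, i ≠ j → cos (2 * π / 5) ≤ cos (θ i - θ j) → False := by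
    intro i j hij hcos
    have h1 := hplanar i j hij
    have h2 := planar_bound (hρnn i) (hρR i) (hρnn j) (hρR j) hc12 hcos
    rw [hpl i j] at h1
    rw [hRsq, hcc] at h2
    linarith
  by_cases hinj : Function.Injective θ
  · -- sort the five angles
    have hAcard : (Finset.univ.image θ).card = 5 := by
      rw [Finset.card_image_of_injective _ hinj, Finset.card_univ, Fintype.card_fin]
    let e := (Finset.univ.image θ).orderEmbOfFin hAcard
    have hmem : ∀ k, ∃ i, θ i = e k := by
      intro k
      have := (Finset.univ.image θ).orderEmbOfFin_mem hAcard k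
      rw [Finset.mem_image] at this
      obtain ⟨i, -, hi⟩ := this
      exact ⟨i, hi⟩
    choose π' hπ' using hmem
    obtain ⟨i, j, hij, hcos⟩ := five_sorted_angles_exists_cos_ge (fun k => e k) e.strictMono
      (by show -π < e 0; rw [← hπ' 0]; exact Complex.neg_pi_lt_arg _)
      (by show e 4 ≤ π; rw [← hπ' 4]; exact Complex.arg_le_pi _)
    have hne : π' i ≠ π' j := by
      intro h
      apply hij
      apply e.injective
      rw [← hπ' i, ← hπ' j, h]
    refine pair_false (π' i) (π' j) hne ?_
    rw [hπ' i, hπ' j]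
    exact hcos
  · obtain ⟨i, j, hθij, hij⟩ := Function.not_injective_iff.1 hinj
    refine pair_false i j hij ?_
    rw [hθij, sub_self, cos_zero]
    linarith

end Summit.AtomisticToContinuum.Crystallization.Theorems.FrustratedLawDichotomyLensFive

end
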